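import Summits.QuantumFields.BalabanUV.Beta.GAN24.WardResidualSRecursionAll
import Summits.QuantumFields.BalabanUV.Beta.GAN24.WardResidualSUnroll
import Summits.QuantumFields.BalabanUV.Beta.GAN24.WardResidualLabelSums

/-!
# `BalabanUV.Beta.GAN24.WardResidualSUnrolled` — binder row G-an2-4 / (CONV-C), CT-W route of record «WC-TL», (Q-R) by «QR-LL» (RULING-preview R-gan24p1-g25-1), row (REP):
# **THE WARD-LOCUS RESIDUAL AT EVERY LEVEL, UNROLLED** — `WardResidualSRecursionAll.exists_kernelLaws_vertexForm` (the residual is `vertexOfK G_j (Φ j y) + Ψ j y`, `Φ`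
# runs the S-step with block-summed label) composed with `WardResidualSUnroll.apply_eq_transport_blockSum` (Duhamel + block sums nest): the table `Φ n` at a label `Y` IS
# the PLAIN S-tower's composite maps applied to the SUPER-BLOCK PARTIAL SUMS of the level-0 letter remainders and of the explicit sources —
# `Φ n Y = 𝒮_{0→n}[Φ_0^{B^n(Y)}] + Σ_{m<n} 𝒮_{m+1→n}[σ_m^{B^{n−1−m}(Y)}]` — the OWNER gan24-p1 g25's (W2) shape; with `WardResidualLabelSums` every partial sum is a
# first-order letter dressed with the super-block generator; §2 `sum_table_zero_eq_letters` spells the level-0 partial sum `Φ_0^{B}` in letters (both slots of leaf-06's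
# `tableLaw_T2RecAt_zero` summed over the labels); §3: at the literal of record (exact Wilson∕border letters: `RW = RW″ = 0`, `RB = RB″ = 0`) `Φ 0 = 0` and every source is the
# K-slot SANDWICH `mmRead Lc (G_m ∘ Ψ m ∘ G_m)` of first-order data — no bare layer letter is ever transported (the OWNER g25's R-2 (3)(ii))  (road-P2 chair
# `b2b-balaban-gan24-p2`, gen 37; (REP) capstone).

NOT IN PRINT; OUR BOOKKEEPING ([folklore] composition of PARTS 2 and 3 BY NAME; the only work is the boundedness of the sources from PART 2's per-level classes and the letters' classes).
HONEST FRAMING (cell contract, verbatim): «discharging `BetaPertH` makes Bałaban's UV stability UNCONDITIONAL — a real constructive-QFT result; it is NOT the continuum limit and NOT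
the Clay problem.»  HONEST DEPENDENCY (verbatim): «continuum YM on T⁴ ⇐ BetaPertH ∧ nine spine estimates (0/9 proved); BetaPertH ⇐ (D1) ∧ (D4) ∧ CAP+tail; G-an2-4 gates
asym, D1 and NE2/3/4.»  No cited fact, no `def`, no `def … : Prop`, 0 sorry.  Asserts NO bound uniform in the level, NO rate: the rows (LAY) ∕ (LT) ∕ (DUH) of «QR-LL» are
what turn this identity into (Q-R); discharges NOTHING of (Q-R) ∕ (C) ∕ «T2Shape» ∕ «T2Drift» ∕ (hW, hWall); NEVER «G-an2-4 closed» as (CONV-C); NOT D1, NOT BetaPertH, NOT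
continuum, NOT Clay.  Unit `b2b-balaban-gan24-p2` (gen 37), 2026-08-22; no existing file touched.
-/

noncomputable section

open Finset
open scoped BigOperators
open Literature.MathematicalPhysics.QuantumFieldTheory
open Literature.MathematicalPhysics.QuantumFieldTheory.Balaban1983to89
open Literature.MathematicalPhysics.QuantumFieldTheory.Balaban1983to89.Beta
open ExpKernelCalculus (MKer Decays VertexFamily comp)
open KernelWard (Bdd divV divW bdd_of_biLoc)
open AffineAveraging (Site box toSite)
open OneStepResolventKernel (Fib wsum LocStencil)
open OneStepKernelFamily (KInvStep colH vertexOfK)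
open InterLevelTransport (cwsum)
open BalabanStepJetsSucc (mmRead wE wVH)
open SecondOrderResponse (colM vertexOfM dM LocStencilFM)
open BalabanCompositeJets (LocStencil₂)
open BalabanStepW2 (M2Of wV4 wB2)
open StepJetData (wilsonA)
open WilsonBiStencil (wilsonW₂)
open AveragingHessianKernelsRooted (vhSAt)
open Summit.QuantumFields.BalabanUV.Beta.TameKernelCalculus
open Summit.QuantumFields.BalabanUV.Beta.ChartConjugation (conjV)
open Summit.QuantumFields.BalabanUV.Beta.BorderedHessian (diagK stepScale)
open Summit.QuantumFields.BalabanUV.Beta.AveragingWardRootedStencils (legInd)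
open Summit.QuantumFields.BalabanUV.Beta.AxialDressingRooted (coDressKBmAt one_le_of_neZero decays_coDressKBmAt_KInvStep)
open Summit.QuantumFields.BalabanUV.Beta.SpineRooted (SpureRecAt M1At T2RecAt WrecAt e3OfK)
open Summit.QuantumFields.BalabanUV.Beta.KernelWardRelative (gaugeWt)
open Summit.QuantumFields.BalabanUV.Beta.GAN24.AffineUnroll (transport)
open Summit.QuantumFields.BalabanUV.Beta.GAN24.WardResidualSRecursionAll (exists_kernelLaws_vertexForm)
open Summit.QuantumFields.BalabanUV.Beta.GAN24.WardResidualSUnroll (apply_eq_transport_blockSum)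
open Summit.QuantumFields.BalabanUV.Beta.GAN24.WardResidualLabelSums (sum_remainder_of_tableLaw sum_remainder_of_tableLaw'')
open Summit.QuantumFields.BalabanUV.Beta.WardLocusQuarticTable (tableLaw_T2RecAt_zero tableLaw_T2RecAt_zero'')

namespace Summit.QuantumFields.BalabanUV.Beta.GAN24.WardResidualSUnrolled

variable {d Lc : ℕ} [NeZero Lc]

/-- NOT IN PRINT; OUR BOOKKEEPING ([folklore] composition BY NAME).  **THE WARD-LOCUS RESIDUAL AT EVERY LEVEL, UNROLLED** (hypotheses = PART 2's = leaf-06's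
`WardLocusRecursiveLetters.exists_kernelLaws_of_letters` minus the row parities): `∃ Φ Ψ`, (Ψ) explicit first-order data, (Φ₀) half the sum of the four level-0 letter remainders,
(UNROLLED) `Φ n Y κ′u′ = transport 𝔖 0 n (Σ_{w∈box Lc^n} Φ 0 (Lc^n•Y+w)) κ′u′ + Σ_{m<n} transport 𝔖 (m+1) (n−1−m) (Σ_{w∈box Lc^{n−1−m}} σ m (Lc^{n−1−m}•Y+w)) κ′u′` with the PLAIN
S-steps `𝔖 j S = fun κ′u′ ↦ (Lc^{d+1}·wE (j+1)) • e3OfK Lc G_j S κ′u′` and the sources `σ m Y = −(Lc^{d+1}·wE (m+1)) • Σ_v mmRead Lc (G_m ∘ Ψ m (Lc•Y+v) ∘ G_m) + ½ • (RB (m+1) + RB″ (m+1)) Y`,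
and (LAW) `divW (WrecAt j) y ν y′ = conjV (dM G_j Lc S_j M_j ν y′) (X y) + (vertexOfK G_j Lc (Φ j y) ν y′ + Ψ j y ν y′)` for every `j`. -/
theorem exists_kernelLaws_unrolled (hLc : 1 ≤ Lc) {r : Fin (d + 1) → ℕ} (hr : r ∈ box (d + 1) Lc) (cΛ cB : ℝ) {cE₂ : ℝ}
    (hcE₂ : cE₂ = (Lc : ℝ) ^ (2 * (d + 1))) (T : Fin 4 → Fin 4 → Fin 4 → Fin 4 → ℝ)
    {vh₂S : Fin (d + 1) → (Fin (d + 1) → ℤ) → Fin (d + 1) → (Fin (d + 1) → ℤ) → MKer (d + 1) (Fib d)}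
    (hB : ∃ C δ : ℝ, 0 < δ ∧ LocStencil₂ vh₂S C δ)
    {mixFF : Fin (d + 1) → (Fin (d + 1) → ℤ) → Fin (d + 1) → (Fin (d + 1) → ℤ) → MKer (d + 1) (Fib d)}
    (hmix : ∃ C δ : ℝ, 0 < δ ∧ LocStencilFM Lc mixFF C δ)
    -- the LETTERS' remainders (an1's border law both slots ∀ j ≥ 0, an1's mixed law ∀ j, the level-0 Wilson law), their classes (one rate per level; NO row parities needed here)
    {RW RW'' : (Fin (d + 1) → ℤ) → Fin (d + 1) → (Fin (d + 1) → ℤ) → MKer (d + 1) (Fib d)} {RB RB'' : ℕ → (Fin (d + 1) → ℤ) → Fin (d + 1) → (Fin (d + 1) → ℤ) → MKer (d + 1) (Fib d)} {RM : ℕ → (Fin (d + 1) → ℤ) → Fin (d + 1) → (Fin (d + 1) → ℤ) → MKer (d + 1) (Fib d)}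
    (hcls0 : ∃ C δ : ℝ, 0 < δ ∧ (∀ Y, LocStencil (RW Y) C δ) ∧ (∀ Y, LocStencil (RW'' Y) C δ) ∧ (∀ Y, LocStencil (RB 0 Y) C δ) ∧
      (∀ Y, LocStencil (RB'' 0 Y) C δ) ∧ (∀ y, VertexFamily (RM 0 y) Lc C δ))
    (hclsS : ∀ j : ℕ, ∃ C δ : ℝ, 0 < δ ∧ (∀ Y, LocStencil (RB (j + 1) Y) C δ) ∧ (∀ Y, LocStencil (RB'' (j + 1) Y) C δ) ∧
      (∀ y, VertexFamily (RM (j + 1) y) Lc C δ))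
    (hWil : ∀ (Y : Fin (d + 1) → ℤ) (κ' : Fin (d + 1)) (u' : Fin (d + 1) → ℤ),
      (stepScale d Lc 0 * (Lc : ℝ) ^ (d + 1))⁻¹ • ∑ v ∈ box (d + 1) Lc, divV (fun κ u => cE₂ • wilsonW₂ d T κ u κ' u') ((Lc : ℤ) • Y + toSite v) =
        comp (((Lc : ℝ) ^ (d + 1)) • wilsonA d κ' u') (diagK (((1 : ℝ) / 2) • ∑ v ∈ box (d + 1) Lc, legInd (toSite r) ((Lc : ℤ) • Y + toSite v)))
          - comp (diagK (((1 : ℝ) / 2) • ∑ v ∈ box (d + 1) Lc, legInd (toSite r) ((Lc : ℤ) • Y + toSite v))) (((Lc : ℝ) ^ (d + 1)) • wilsonA d κ' u')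
          + RW Y κ' u')
    (hWil'' : ∀ (Y : Fin (d + 1) → ℤ) (κ : Fin (d + 1)) (u : Fin (d + 1) → ℤ),
      (stepScale d Lc 0 * (Lc : ℝ) ^ (d + 1))⁻¹ • ∑ v ∈ box (d + 1) Lc, divV (fun κ' u' => cE₂ • wilsonW₂ d T κ u κ' u') ((Lc : ℤ) • Y + toSite v) =
        comp (((Lc : ℝ) ^ (d + 1)) • wilsonA d κ u) (diagK (((1 : ℝ) / 2) • ∑ v ∈ box (d + 1) Lc, legInd (toSite r) ((Lc : ℤ) • Y + toSite v)))
          - comp (diagK (((1 : ℝ) / 2) • ∑ v ∈ box (d + 1) Lc, legInd (toSite r) ((Lc : ℤ) • Y + toSite v))) (((Lc : ℝ) ^ (d + 1)) • wilsonA d κ u)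
          + RW'' Y κ u)
    (hBord0 : ∀ (Y : Fin (d + 1) → ℤ) (κ' : Fin (d + 1)) (u' : Fin (d + 1) → ℤ),
      (stepScale d Lc 0 * (Lc : ℝ) ^ (d + 1))⁻¹ • ∑ v ∈ box (d + 1) Lc, divV (fun κ u => cB • vh₂S κ u κ' u') ((Lc : ℤ) • Y + toSite v) =
        comp ((-((Lc : ℝ) ^ (d + 1) * (1 / 2) * (Lc : ℝ) ^ (d + 1))) • vhSAt (toSite r) d Lc rfl κ' u') (diagK (((1 : ℝ) / 2) • ∑ v ∈ box (d + 1) Lc, legInd (toSite r) ((Lc : ℤ) • Y + toSite v)))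
          - comp (diagK (((1 : ℝ) / 2) • ∑ v ∈ box (d + 1) Lc, legInd (toSite r) ((Lc : ℤ) • Y + toSite v))) ((-((Lc : ℝ) ^ (d + 1) * (1 / 2) * (Lc : ℝ) ^ (d + 1))) • vhSAt (toSite r) d Lc rfl κ' u')
          + RB 0 Y κ' u')
    (hBord0'' : ∀ (Y : Fin (d + 1) → ℤ) (κ : Fin (d + 1)) (u : Fin (d + 1) → ℤ),
      (stepScale d Lc 0 * (Lc : ℝ) ^ (d + 1))⁻¹ • ∑ v ∈ box (d + 1) Lc, divV (fun κ' u' => cB • vh₂S κ u κ' u') ((Lc : ℤ) • Y + toSite v) =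
        comp ((-((Lc : ℝ) ^ (d + 1) * (1 / 2) * (Lc : ℝ) ^ (d + 1))) • vhSAt (toSite r) d Lc rfl κ u) (diagK (((1 : ℝ) / 2) • ∑ v ∈ box (d + 1) Lc, legInd (toSite r) ((Lc : ℤ) • Y + toSite v)))
          - comp (diagK (((1 : ℝ) / 2) • ∑ v ∈ box (d + 1) Lc, legInd (toSite r) ((Lc : ℤ) • Y + toSite v))) ((-((Lc : ℝ) ^ (d + 1) * (1 / 2) * (Lc : ℝ) ^ (d + 1))) • vhSAt (toSite r) d Lc rfl κ u)
          + RB'' 0 Y κ u)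
    (hBordS : ∀ (j : ℕ) (Y : Fin (d + 1) → ℤ) (κ' : Fin (d + 1)) (u' : Fin (d + 1) → ℤ),
      (stepScale d Lc (j + 1) * (Lc : ℝ) ^ (d + 1))⁻¹ •
          ∑ v ∈ box (d + 1) Lc, divV (fun κ u => (cB * wB2 d Lc (j + 1)) • vh₂S κ u κ' u') ((Lc : ℤ) • Y + toSite v) =
        comp ((-((Lc : ℝ) ^ (d + 1) * (1 / 2) * (Lc : ℝ) ^ (d + 1)) * wVH d Lc (j + 1)) • vhSAt (toSite r) d Lc rfl κ' u') (diagK (((1 : ℝ) / 2) • ∑ v ∈ box (d + 1) Lc, legInd (toSite r) ((Lc : ℤ) • Y + toSite v)))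
          - comp (diagK (((1 : ℝ) / 2) • ∑ v ∈ box (d + 1) Lc, legInd (toSite r) ((Lc : ℤ) • Y + toSite v))) ((-((Lc : ℝ) ^ (d + 1) * (1 / 2) * (Lc : ℝ) ^ (d + 1)) * wVH d Lc (j + 1)) • vhSAt (toSite r) d Lc rfl κ' u')
          + RB (j + 1) Y κ' u')
    (hBordS'' : ∀ (j : ℕ) (Y : Fin (d + 1) → ℤ) (κ : Fin (d + 1)) (u : Fin (d + 1) → ℤ),
      (stepScale d Lc (j + 1) * (Lc : ℝ) ^ (d + 1))⁻¹ •
          ∑ v ∈ box (d + 1) Lc, divV (fun κ' u' => (cB * wB2 d Lc (j + 1)) • vh₂S κ u κ' u') ((Lc : ℤ) • Y + toSite v) =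
        comp ((-((Lc : ℝ) ^ (d + 1) * (1 / 2) * (Lc : ℝ) ^ (d + 1)) * wVH d Lc (j + 1)) • vhSAt (toSite r) d Lc rfl κ u) (diagK (((1 : ℝ) / 2) • ∑ v ∈ box (d + 1) Lc, legInd (toSite r) ((Lc : ℤ) • Y + toSite v)))
          - comp (diagK (((1 : ℝ) / 2) • ∑ v ∈ box (d + 1) Lc, legInd (toSite r) ((Lc : ℤ) • Y + toSite v))) ((-((Lc : ℝ) ^ (d + 1) * (1 / 2) * (Lc : ℝ) ^ (d + 1)) * wVH d Lc (j + 1)) • vhSAt (toSite r) d Lc rfl κ u)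
          + RB'' (j + 1) Y κ u)
    (hM₂ : ∀ (j : ℕ) (y : Fin (d + 1) → ℤ) (ρ' : Fin (d + 1)) (w : Fin (d + 1) → ℤ),
      (stepScale d Lc j * (Lc : ℝ) ^ (d + 1))⁻¹ • ∑ v ∈ box (d + 1) Lc, divV (fun κ u => M2Of d Lc mixFF j κ u ρ' w) ((Lc : ℤ) • y + toSite v) =
        comp (M1At d Lc (toSite r) cΛ j ρ' w) (diagK (((1 : ℝ) / 2) • ∑ v ∈ box (d + 1) Lc, legInd (toSite r) ((Lc : ℤ) • y + toSite v)))
          - comp (diagK (((1 : ℝ) / 2) • ∑ v ∈ box (d + 1) Lc, legInd (toSite r) ((Lc : ℤ) • y + toSite v))) (M1At d Lc (toSite r) cΛ j ρ' w)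
          + RM j y ρ' w) :
    ∃ Φ Ψ : ℕ → (Fin (d + 1) → ℤ) → Fin (d + 1) → (Fin (d + 1) → ℤ) → MKer (d + 1) (Fib d),
      -- (Ψ) explicit first-order data (as in `WardResidualSRecursionAll.exists_kernelLaws_vertexForm`)
      (∀ (j : ℕ) (y : Fin (d + 1) → ℤ) (ν : Fin (d + 1)) (y' : Fin (d + 1) → ℤ), Ψ j y ν y' =
        vertexOfM (coDressKBmAt (toSite r) Lc (KInvStep (d := d) Lc j)) Lc (RM j y) ν y'
        + (1 / 2 : ℝ) • (dM (conjV (coDressKBmAt (toSite r) Lc (KInvStep (d := d) Lc j))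
                (diagK (((1 : ℝ) / 2) • ∑ v ∈ box (d + 1) Lc, legInd (toSite r) ((Lc : ℤ) • y + toSite v)))) Lc
              (SpureRecAt d Lc (toSite r) ((Lc : ℝ) ^ (d + 1)) (-((Lc : ℝ) ^ (d + 1) * (1 / 2) * (Lc : ℝ) ^ (d + 1))) cΛ j)
              (M1At d Lc (toSite r) cΛ j) ν y'
          - (stepScale d Lc j * (Lc : ℝ) ^ (d + 1))⁻¹ • (∑ κ, wsum (fun u => ∑' x₂, ∑ κ₂,
              comp (coDressKBmAt (toSite r) Lc (KInvStep (d := d) Lc j))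
                (dM (coDressKBmAt (toSite r) Lc (KInvStep (d := d) Lc j)) Lc
                  (SpureRecAt d Lc (toSite r) ((Lc : ℝ) ^ (d + 1)) (-((Lc : ℝ) ^ (d + 1) * (1 / 2) * (Lc : ℝ) ^ (d + 1))) cΛ j)
                  (M1At d Lc (toSite r) cΛ j) ν y') u x₂ (Sum.inl κ) (Sum.inl κ₂) * gaugeWt Lc y κ₂ x₂)
              (SpureRecAt d Lc (toSite r) ((Lc : ℝ) ^ (d + 1)) (-((Lc : ℝ) ^ (d + 1) * (1 / 2) * (Lc : ℝ) ^ (d + 1))) cΛ j κ)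
            + ∑ ρ', cwsum Lc (fun w => ∑' x₂, ∑ κ₂,
              comp (coDressKBmAt (toSite r) Lc (KInvStep (d := d) Lc j))
                (dM (coDressKBmAt (toSite r) Lc (KInvStep (d := d) Lc j)) Lc
                  (SpureRecAt d Lc (toSite r) ((Lc : ℝ) ^ (d + 1)) (-((Lc : ℝ) ^ (d + 1) * (1 / 2) * (Lc : ℝ) ^ (d + 1))) cΛ j)
                  (M1At d Lc (toSite r) cΛ j) ν y') ((Lc : ℤ) • w) x₂ (Sum.inr ρ') (Sum.inl κ₂) * gaugeWt Lc y κ₂ x₂)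
              (M1At d Lc (toSite r) cΛ j ρ')))) ∧
      -- (Φ₀)
      (Φ 0 = fun y κ u => (1 / 2 : ℝ) • ((RW y κ u + RB 0 y κ u) + (RW'' y κ u + RB'' 0 y κ u))) ∧
      -- (UNROLLED) THE TABLE AT LEVEL `n` = THE PLAIN S-TOWER's COMPOSITE MAPS APPLIED TO THE SUPER-BLOCK PARTIAL SUMS OF `Φ 0` AND OF THE SOURCES
      (∀ (n : ℕ) (Y : Fin (d + 1) → ℤ) (κ' : Fin (d + 1)) (u' : Fin (d + 1) → ℤ), Φ n Y κ' u' =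
        transport (fun j (S : Fin (d + 1) → (Fin (d + 1) → ℤ) → MKer (d + 1) (Fib d)) => fun κ' u' => ((Lc : ℝ) ^ (d + 1) * wE d Lc (j + 1)) • e3OfK Lc (coDressKBmAt (toSite r) Lc (KInvStep (d := d) Lc j)) S κ' u') 0 n
            (∑ w ∈ box (d + 1) (Lc ^ n), Φ 0 (((Lc ^ n : ℕ) : ℤ) • Y + toSite w)) κ' u'
        + ∑ m ∈ Finset.range n, transport (fun j (S : Fin (d + 1) → (Fin (d + 1) → ℤ) → MKer (d + 1) (Fib d)) => fun κ' u' => ((Lc : ℝ) ^ (d + 1) * wE d Lc (j + 1)) • e3OfK Lc (coDressKBmAt (toSite r) Lc (KInvStep (d := d) Lc j)) S κ' u') (m + 1) (n - 1 - m)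
            (∑ w ∈ box (d + 1) (Lc ^ (n - 1 - m)),
              (fun (m : ℕ) (Y : Fin (d + 1) → ℤ) (κ' : Fin (d + 1)) (u' : Fin (d + 1) → ℤ) =>
              (-((Lc : ℝ) ^ (d + 1) * wE d Lc (m + 1))) • ∑ v ∈ box (d + 1) Lc,
                  mmRead Lc (comp (comp (coDressKBmAt (toSite r) Lc (KInvStep (d := d) Lc m)) (Ψ m ((Lc : ℤ) • Y + toSite v) κ' u')) (coDressKBmAt (toSite r) Lc (KInvStep (d := d) Lc m)))
                + (1 / 2 : ℝ) • (RB (m + 1) Y κ' u' + RB'' (m + 1) Y κ' u')) m (((Lc ^ (n - 1 - m) : ℕ) : ℤ) • Y + toSite w)) κ' u') ∧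
      -- (LAW) the Ward kernel law at every level with the residual in vertex form
      (∀ (j : ℕ) (y : Fin (d + 1) → ℤ) (ν : Fin (d + 1)) (y' : Fin (d + 1) → ℤ),
        divW (WrecAt d Lc (toSite r) ((Lc : ℝ) ^ (d + 1)) (-((Lc : ℝ) ^ (d + 1) * (1 / 2) * (Lc : ℝ) ^ (d + 1))) cΛ cE₂ cB T vh₂S mixFF j) y ν y' =
          conjV (dM (coDressKBmAt (toSite r) Lc (KInvStep (d := d) Lc j)) Lc
            (SpureRecAt d Lc (toSite r) ((Lc : ℝ) ^ (d + 1)) (-((Lc : ℝ) ^ (d + 1) * (1 / 2) * (Lc : ℝ) ^ (d + 1))) cΛ j)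
            (M1At d Lc (toSite r) cΛ j) ν y')
          (diagK (((1 : ℝ) / 2) • ∑ v ∈ box (d + 1) Lc, legInd (toSite r) ((Lc : ℤ) • y + toSite v)))
        + (vertexOfK (coDressKBmAt (toSite r) Lc (KInvStep (d := d) Lc j)) Lc (Φ j y) ν y' + Ψ j y ν y')) := by
  obtain ⟨Φ, Ψ, hΨ, hΦ0, hΦS, hΦcls, hNcls, hlaw⟩ :=
    exists_kernelLaws_vertexForm hLc hr cΛ cB hcE₂ T hB hmix hcls0 hclsS hWil hWil'' hBord0 hBord0'' hBordS hBordS'' hM₂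
  refine ⟨Φ, Ψ, hΨ, hΦ0, fun n Y κ' u' => ?_, hlaw⟩
  have hG : ∀ j, ∃ δ C : ℝ, 0 < δ ∧ 0 ≤ C ∧ Decays (coDressKBmAt (toSite r) Lc (KInvStep (d := d) Lc j)) C δ := fun j => decays_coDressKBmAt_KInvStep (d := d) hr j
  -- boundedness of `Φ 0` and of every source (classes of PART 2 + the letters' classes)
  have hΦb : ∀ j, ∃ B : ℝ, ∀ y κ u x z a b, |Φ j y κ u x z a b| ≤ B := fun j => by
    obtain ⟨C, δ, hδ, h⟩ := hΦcls j
    exact ⟨C, fun y κ u x z a b => bdd_of_biLoc (h y κ u) hδ.le x z a b⟩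
  have hΨb : ∀ j, ∃ B : ℝ, ∀ y ν y' x z a b, |Ψ j y ν y' x z a b| ≤ B := fun j => by
    obtain ⟨CΦ, hΦ⟩ := hΦb j
    obtain ⟨CN, δN, hδN, hN⟩ := hNcls j
    obtain ⟨δ0, C0, hδ0, hC0, hK0⟩ := hG j
    refine ⟨CN + ((d + 1 : ℕ) : ℝ) * (C0 * ExpKernelCalculus.Zl (d + 1) δ0 * CΦ), fun y ν y' x z a b => ?_⟩
    have h1 : |(vertexOfK (coDressKBmAt (toSite r) Lc (KInvStep (d := d) Lc j)) Lc (Φ j y) ν y' + Ψ j y ν y') x z a b| ≤ CN := bdd_of_biLoc (hN y ν y') hδN.le x z a b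
    have h2 := Lin4Additive.abs_vertexOfK_le hK0 hδ0 Lc (hΦ y) ν y' x z a b
    have h3 := abs_add_le (-(vertexOfK (coDressKBmAt (toSite r) Lc (KInvStep (d := d) Lc j)) Lc (Φ j y) ν y' x z a b)) ((vertexOfK (coDressKBmAt (toSite r) Lc (KInvStep (d := d) Lc j)) Lc (Φ j y) ν y' + Ψ j y ν y') x z a b)
    rw [abs_neg] at h3
    have e : Ψ j y ν y' x z a b = -(vertexOfK (coDressKBmAt (toSite r) Lc (KInvStep (d := d) Lc j)) Lc (Φ j y) ν y' x z a b)
        + (vertexOfK (coDressKBmAt (toSite r) Lc (KInvStep (d := d) Lc j)) Lc (Φ j y) ν y' + Ψ j y ν y') x z a b := by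
      simp only [Pi.add_apply]; ring
    rw [e]
    linarith
  have hσ : ∀ m, ∃ B : ℝ, ∀ y κ u x z a b, |(fun (m : ℕ) (Y : Fin (d + 1) → ℤ) (κ' : Fin (d + 1)) (u' : Fin (d + 1) → ℤ) =>
              (-((Lc : ℝ) ^ (d + 1) * wE d Lc (m + 1))) • ∑ v ∈ box (d + 1) Lc,
                  mmRead Lc (comp (comp (coDressKBmAt (toSite r) Lc (KInvStep (d := d) Lc m)) (Ψ m ((Lc : ℤ) • Y + toSite v) κ' u')) (coDressKBmAt (toSite r) Lc (KInvStep (d := d) Lc m)))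
                + (1 / 2 : ℝ) • (RB (m + 1) Y κ' u' + RB'' (m + 1) Y κ' u')) m y κ u x z a b| ≤ B := fun m => by
    obtain ⟨δ0, C0, hδ0, hC0, hK0⟩ := hG m
    obtain ⟨BΨ, hΨm⟩ := hΨb m
    obtain ⟨CL, δL, hδL, hRBl, hRB''l, -⟩ := hclsS m
    have hsand : ∀ y κ u, Bdd (mmRead Lc (comp (comp (coDressKBmAt (toSite r) Lc (KInvStep (d := d) Lc m)) (Ψ m y κ u)) (coDressKBmAt (toSite r) Lc (KInvStep (d := d) Lc m)))) _ :=
      fun y κ u => Lin4Additive.bdd_mmRead (Lin4Additive.bdd_comp_bdd_decays (Lin4Additive.bdd_comp_decays_bdd hK0 hδ0 (fun x z a b => hΨm y κ u x z a b)) hK0 hδ0) Lc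
    refine ⟨∑ _v ∈ box (d + 1) Lc, |(-((Lc : ℝ) ^ (d + 1) * wE d Lc (m + 1)))| *
        ((Fintype.card (Fib d) : ℝ) * ((Fintype.card (Fib d) : ℝ) * (C0 * ExpKernelCalculus.Zl (d + 1) δ0 * BΨ) * (C0 * ExpKernelCalculus.Zl (d + 1) δ0)))
        + |(1 / 2 : ℝ)| * (CL + CL), fun y κ u x z a b => ?_⟩
    simp only [Pi.add_apply, Pi.smul_apply, Finset.sum_apply, smul_eq_mul]
    refine (abs_add_le _ _).trans (add_le_add ?_ ?_)
    · rw [Finset.mul_sum]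
      refine (Finset.abs_sum_le_sum_abs _ _).trans (Finset.sum_le_sum fun v _ => ?_)
      rw [abs_mul]
      exact mul_le_mul_of_nonneg_left (hsand _ κ u x z a b) (abs_nonneg _)
    · rw [abs_mul]
      refine mul_le_mul_of_nonneg_left ((abs_add_le _ _).trans (add_le_add ?_ ?_)) (abs_nonneg _)
      · exact bdd_of_biLoc (hRBl y κ u) hδL.le x z a b
      · exact bdd_of_biLoc (hRB''l y κ u) hδL.le x z a b
  have hrec : ∀ j, Φ (j + 1) = (fun Y κ' u' => ∑ v ∈ box (d + 1) Lc, ((Lc : ℝ) ^ (d + 1) * wE d Lc (j + 1)) •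
      e3OfK Lc (coDressKBmAt (toSite r) Lc (KInvStep (d := d) Lc j)) (Φ j ((Lc : ℤ) • Y + toSite v)) κ' u') + (fun (m : ℕ) (Y : Fin (d + 1) → ℤ) (κ' : Fin (d + 1)) (u' : Fin (d + 1) → ℤ) =>
              (-((Lc : ℝ) ^ (d + 1) * wE d Lc (m + 1))) • ∑ v ∈ box (d + 1) Lc,
                  mmRead Lc (comp (comp (coDressKBmAt (toSite r) Lc (KInvStep (d := d) Lc m)) (Ψ m ((Lc : ℤ) • Y + toSite v) κ' u')) (coDressKBmAt (toSite r) Lc (KInvStep (d := d) Lc m)))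
                + (1 / 2 : ℝ) • (RB (m + 1) Y κ' u' + RB'' (m + 1) Y κ' u')) j := fun j => by
    rw [hΦS j]
    rfl
  exact apply_eq_transport_blockSum Lc (fun j => (coDressKBmAt (toSite r) Lc (KInvStep (d := d) Lc j))) (fun j => (Lc : ℝ) ^ (d + 1) * wE d Lc (j + 1)) hG (one_le_of_neZero Lc)
    (Φ := Φ) (σ := (fun (m : ℕ) (Y : Fin (d + 1) → ℤ) (κ' : Fin (d + 1)) (u' : Fin (d + 1) → ℤ) =>
              (-((Lc : ℝ) ^ (d + 1) * wE d Lc (m + 1))) • ∑ v ∈ box (d + 1) Lc,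
                  mmRead Lc (comp (comp (coDressKBmAt (toSite r) Lc (KInvStep (d := d) Lc m)) (Ψ m ((Lc : ℤ) • Y + toSite v) κ' u')) (coDressKBmAt (toSite r) Lc (KInvStep (d := d) Lc m)))
                + (1 / 2 : ℝ) • (RB (m + 1) Y κ' u' + RB'' (m + 1) Y κ' u'))) (hΦb 0) hσ hrec n Y κ' u'

/-! ## §2 The level-0 partial sums in letters -/

/-- [folklore] **THE SUPER-BLOCK PARTIAL SUM OF THE LEVEL-0 TABLE IS A LETTER**: for every finset `T` of labels, `Σ_{y∈T} Φ 0 y κ′u′` (`Φ 0 = ½((RW + RB₀) + (RW″ + RB″₀))`,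
the remainders of the Wilson and border letters at level 0) equals
`½ • [(cH′ • Σ_{y∈T} Σ_{v∈box} divV (T̃_0 · · κ′u′) (Lc•y+v) − [S_0 κ′u′, X_T]) + (cH′ • Σ_{y∈T} Σ_v divV (T̃_0 κ′u′) (Lc•y+v) − [S_0 κ′u′, X_T])]`, `T̃_0 = T2RecAt 0 = cE₂ • wilsonW₂ + cB • vh₂S`,
`S_0 = SpureRecAt 0`, `X_T = diagK (Σ_{y∈T} ½ • Σ_v legInd ρ (Lc•y+v))` — leaf-06's `tableLaw_T2RecAt_zero ∕ ''` summed over the labels by `WardResidualLabelSums.sum_remainder_of_tableLaw ∕ ''`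
(the OWNER gan24-p1 g25's «`Φ_0^{B} = cH′_0 • T̃_0(∇1_B, ·) − [S_0(·), X_B]`», both slots).  No `tsum`, no class: finite algebra over the letters. -/
theorem sum_table_zero_eq_letters {r : Fin (d + 1) → ℕ} (cΛ cE₂ cB : ℝ) (T : Fin 4 → Fin 4 → Fin 4 → Fin 4 → ℝ)
    (vh₂S mixFF : Fin (d + 1) → (Fin (d + 1) → ℤ) → Fin (d + 1) → (Fin (d + 1) → ℤ) → MKer (d + 1) (Fib d)) {cH' : ℝ}
    {RW RB RW'' RB'' : (Fin (d + 1) → ℤ) → Fin (d + 1) → (Fin (d + 1) → ℤ) → MKer (d + 1) (Fib d)}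
    (hWil : ∀ (Y : Fin (d + 1) → ℤ) (κ' : Fin (d + 1)) (u' : Fin (d + 1) → ℤ),
      cH' • ∑ v ∈ box (d + 1) Lc, divV (fun κ u => cE₂ • wilsonW₂ d T κ u κ' u') ((Lc : ℤ) • Y + toSite v) =
        comp (((Lc : ℝ) ^ (d + 1)) • wilsonA d κ' u') (diagK (((1 : ℝ) / 2) • ∑ v ∈ box (d + 1) Lc, legInd (toSite r) ((Lc : ℤ) • Y + toSite v)))
          - comp (diagK (((1 : ℝ) / 2) • ∑ v ∈ box (d + 1) Lc, legInd (toSite r) ((Lc : ℤ) • Y + toSite v))) (((Lc : ℝ) ^ (d + 1)) • wilsonA d κ' u')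
          + RW Y κ' u')
    (hWil'' : ∀ (Y : Fin (d + 1) → ℤ) (κ : Fin (d + 1)) (u : Fin (d + 1) → ℤ),
      cH' • ∑ v ∈ box (d + 1) Lc, divV (fun κ' u' => cE₂ • wilsonW₂ d T κ u κ' u') ((Lc : ℤ) • Y + toSite v) =
        comp (((Lc : ℝ) ^ (d + 1)) • wilsonA d κ u) (diagK (((1 : ℝ) / 2) • ∑ v ∈ box (d + 1) Lc, legInd (toSite r) ((Lc : ℤ) • Y + toSite v)))
          - comp (diagK (((1 : ℝ) / 2) • ∑ v ∈ box (d + 1) Lc, legInd (toSite r) ((Lc : ℤ) • Y + toSite v))) (((Lc : ℝ) ^ (d + 1)) • wilsonA d κ u)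
          + RW'' Y κ u)
    (hBord : ∀ (Y : Fin (d + 1) → ℤ) (κ' : Fin (d + 1)) (u' : Fin (d + 1) → ℤ),
      cH' • ∑ v ∈ box (d + 1) Lc, divV (fun κ u => cB • vh₂S κ u κ' u') ((Lc : ℤ) • Y + toSite v) =
        comp ((-((Lc : ℝ) ^ (d + 1) * (1 / 2) * (Lc : ℝ) ^ (d + 1))) • vhSAt (toSite r) d Lc rfl κ' u')
            (diagK (((1 : ℝ) / 2) • ∑ v ∈ box (d + 1) Lc, legInd (toSite r) ((Lc : ℤ) • Y + toSite v)))
          - comp (diagK (((1 : ℝ) / 2) • ∑ v ∈ box (d + 1) Lc, legInd (toSite r) ((Lc : ℤ) • Y + toSite v)))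
            ((-((Lc : ℝ) ^ (d + 1) * (1 / 2) * (Lc : ℝ) ^ (d + 1))) • vhSAt (toSite r) d Lc rfl κ' u')
          + RB Y κ' u')
    (hBord'' : ∀ (Y : Fin (d + 1) → ℤ) (κ : Fin (d + 1)) (u : Fin (d + 1) → ℤ),
      cH' • ∑ v ∈ box (d + 1) Lc, divV (fun κ' u' => cB • vh₂S κ u κ' u') ((Lc : ℤ) • Y + toSite v) =
        comp ((-((Lc : ℝ) ^ (d + 1) * (1 / 2) * (Lc : ℝ) ^ (d + 1))) • vhSAt (toSite r) d Lc rfl κ u)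
            (diagK (((1 : ℝ) / 2) • ∑ v ∈ box (d + 1) Lc, legInd (toSite r) ((Lc : ℤ) • Y + toSite v)))
          - comp (diagK (((1 : ℝ) / 2) • ∑ v ∈ box (d + 1) Lc, legInd (toSite r) ((Lc : ℤ) • Y + toSite v)))
            ((-((Lc : ℝ) ^ (d + 1) * (1 / 2) * (Lc : ℝ) ^ (d + 1))) • vhSAt (toSite r) d Lc rfl κ u)
          + RB'' Y κ u)
    (Tl : Finset (Fin (d + 1) → ℤ)) (κ' : Fin (d + 1)) (u' : Fin (d + 1) → ℤ) :
    ∑ y ∈ Tl, (fun (y : Fin (d + 1) → ℤ) (κ : Fin (d + 1)) (u : Fin (d + 1) → ℤ) =>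
        (1 / 2 : ℝ) • ((RW y κ u + RB y κ u) + (RW'' y κ u + RB'' y κ u))) y κ' u' =
      (1 / 2 : ℝ) • (
        (cH' • ∑ y ∈ Tl, ∑ v ∈ box (d + 1) Lc, divV (fun κ u => T2RecAt d Lc (toSite r) ((Lc : ℝ) ^ (d + 1)) (-((Lc : ℝ) ^ (d + 1) * (1 / 2) * (Lc : ℝ) ^ (d + 1))) cΛ cE₂ cB T vh₂S mixFF 0 κ u κ' u') ((Lc : ℤ) • y + toSite v)
          - (comp (SpureRecAt d Lc (toSite r) ((Lc : ℝ) ^ (d + 1)) (-((Lc : ℝ) ^ (d + 1) * (1 / 2) * (Lc : ℝ) ^ (d + 1))) cΛ 0 κ' u') (diagK (∑ y ∈ Tl, ((1 : ℝ) / 2) • ∑ v ∈ box (d + 1) Lc, legInd (toSite r) ((Lc : ℤ) • y + toSite v))) - comp (diagK (∑ y ∈ Tl, ((1 : ℝ) / 2) • ∑ v ∈ box (d + 1) Lc, legInd (toSite r) ((Lc : ℤ) • y + toSite v))) (SpureRecAt d Lc (toSite r) ((Lc : ℝ) ^ (d + 1)) (-((Lc : ℝ) ^ (d + 1) * (1 /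 2) * (Lc : ℝ) ^ (d + 1))) cΛ 0 κ' u')))
        + (cH' • ∑ y ∈ Tl, ∑ v ∈ box (d + 1) Lc, divV (T2RecAt d Lc (toSite r) ((Lc : ℝ) ^ (d + 1)) (-((Lc : ℝ) ^ (d + 1) * (1 / 2) * (Lc : ℝ) ^ (d + 1))) cΛ cE₂ cB T vh₂S mixFF 0 κ' u') ((Lc : ℤ) • y + toSite v)
          - (comp (SpureRecAt d Lc (toSite r) ((Lc : ℝ) ^ (d + 1)) (-((Lc : ℝ) ^ (d + 1) * (1 / 2) * (Lc : ℝ) ^ (d + 1))) cΛ 0 κ' u') (diagK (∑ y ∈ Tl, ((1 : ℝ) / 2) • ∑ v ∈ box (d + 1) Lc, legInd (toSite r) ((Lc : ℤ) • y + toSite v))) - comp (diagK (∑ y ∈ Tl, ((1 : ℝ) / 2) • ∑ v ∈ box (d + 1) Lc, legInd (toSite r) ((Lc : ℤ) • y + toSite v))) (SpureRecAt d Lc (toSite r) ((Lc : ℝ) ^ (d + 1)) (-((Lc : ℝ) ^ (d + 1) * (1 / 2) * (Lc : ℝ) ^ (d + 1))) cΛ 0 κ' u')))) := by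
  have h1 := sum_remainder_of_tableLaw (lab := fun y : Fin (d + 1) → ℤ => y) (R := fun y κ' u' => RW y κ' u' + RB y κ' u')
    (fun y κ' u' => tableLaw_T2RecAt_zero (Lc := Lc) cΛ cE₂ cB T vh₂S mixFF hWil hBord y κ' u') Tl κ' u'
  have h2 := sum_remainder_of_tableLaw'' (lab := fun y : Fin (d + 1) → ℤ => y) (R'' := fun y κ u => RW'' y κ u + RB'' y κ u)
    (fun y κ u => tableLaw_T2RecAt_zero'' (Lc := Lc) cΛ cE₂ cB T vh₂S mixFF hWil'' hBord'' y κ u) Tl κ' u'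
  rw [← h1, ← h2, ← Finset.sum_add_distrib, Finset.smul_sum]

/-! ## §3 The literal of record: exact Wilson and border letters ⇒ no bare layer letter is ever transported -/

/-- [folklore] **WITH EXACT LEVEL-0 LETTERS THE LEVEL-0 TABLE VANISHES**: if the Wilson letter's and the border letter's remainders are `0` in both slots (leaf-09's
`WilsonBiStencilWardSocket.hS₂_wilson ∕ hS₂''_wilson` at `T := wsym22 N`: `RW = RW″ = 0`; an1's border law: `RB = RB″ = 0`), then `Φ 0 = ½((RW + RB 0) + (RW″ + RB″ 0)) = 0` —
so in `exists_kernelLaws_unrolled` the term `transport 𝔖 0 n (Σ_w Φ 0 (…))` is the transport of `0`. -/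
theorem table_zero_eq_zero_of_letters {RW RW'' : (Fin (d + 1) → ℤ) → Fin (d + 1) → (Fin (d + 1) → ℤ) → MKer (d + 1) (Fib d)}
    {RB RB'' : ℕ → (Fin (d + 1) → ℤ) → Fin (d + 1) → (Fin (d + 1) → ℤ) → MKer (d + 1) (Fib d)}
    (hRW : ∀ y κ u, RW y κ u = 0) (hRW'' : ∀ y κ u, RW'' y κ u = 0) (hRB : ∀ y κ u, RB 0 y κ u = 0) (hRB'' : ∀ y κ u, RB'' 0 y κ u = 0)
    (y : Fin (d + 1) → ℤ) (κ : Fin (d + 1)) (u : Fin (d + 1) → ℤ) :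
    (1 / 2 : ℝ) • ((RW y κ u + RB 0 y κ u) + (RW'' y κ u + RB'' 0 y κ u)) = 0 := by
  rw [hRW, hRW'', hRB, hRB'', add_zero, add_zero, smul_zero]

/-- [folklore] **WITH AN EXACT BORDER LETTER EVERY SOURCE IS A RESOLVENT SANDWICH**: if `RB (m+1) = RB″ (m+1) = 0` (an1), the level-`m` source of the table tower is
`σ m Y κ′u′ = (−(Lc^{d+1}·wE (m+1))) • Σ_{v∈box} mmRead Lc (G_m ∘ Ψ m (Lc•Y+v) κ′u′ ∘ G_m)` — the K-SLOT SANDWICH (mm-read between two copies of the dressed resolvent) of the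
first-order data `Ψ m`; no bare table is ever handed to the transport. -/
theorem source_eq_sandwich_of_border {Ψ : ℕ → (Fin (d + 1) → ℤ) → Fin (d + 1) → (Fin (d + 1) → ℤ) → MKer (d + 1) (Fib d)}
    {RB RB'' : ℕ → (Fin (d + 1) → ℤ) → Fin (d + 1) → (Fin (d + 1) → ℤ) → MKer (d + 1) (Fib d)} {r : Fin (d + 1) → ℕ} (m : ℕ)
    (hRB : ∀ Y κ u, RB (m + 1) Y κ u = 0) (hRB'' : ∀ Y κ u, RB'' (m + 1) Y κ u = 0)
    (Y : Fin (d + 1) → ℤ) (κ' : Fin (d + 1)) (u' : Fin (d + 1) → ℤ) :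
    (-((Lc : ℝ) ^ (d + 1) * wE d Lc (m + 1))) • ∑ v ∈ box (d + 1) Lc,
        mmRead Lc (comp (comp (coDressKBmAt (toSite r) Lc (KInvStep (d := d) Lc m)) (Ψ m ((Lc : ℤ) • Y + toSite v) κ' u')) (coDressKBmAt (toSite r) Lc (KInvStep (d := d) Lc m)))
      + (1 / 2 : ℝ) • (RB (m + 1) Y κ' u' + RB'' (m + 1) Y κ' u') =
    (-((Lc : ℝ) ^ (d + 1) * wE d Lc (m + 1))) • ∑ v ∈ box (d + 1) Lc,
        mmRead Lc (comp (comp (coDressKBmAt (toSite r) Lc (KInvStep (d := d) Lc m)) (Ψ m ((Lc : ℤ) • Y + toSite v) κ' u')) (coDressKBmAt (toSite r) Lc (KInvStep (d := d) Lc m))) := by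
  rw [hRB, hRB'', add_zero, smul_zero, add_zero]

end Summit.QuantumFields.BalabanUV.Beta.GAN24.WardResidualSUnrolled

end
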